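import Summits.AtomisticToContinuum.Crystallization.Theses.ExcessDecayLiouville
import Literature.MathematicalPhysics.StatisticalMechanics.LennardJonesClusters

/-!
# Line `interior-oscillation-decay` — crux `ExcessDecayLiouville.CoarseGrains` (stmt-AtomisticToContinuum-9331)

Skeleton (crux-plan, round 1) of idea card `interior-oscillation-decay` (ideator 1, triage r1-1: pass).

EQUATIONS GLUE THE GRAIN.  The route's own foreseen split of `CoarseGrains`
(`LocalHcpLikeness(1/40) → Propagation by pigeonhole`) fails by BENDING DRIFT: a defect-free elastically
bent crystal is locally hcp to any fixed tolerance at every particle yet deviates from every single affine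
two-lattice by `κR²` on `B_R` (triage §A).  Pure geometry cannot cap the curvature `κ`; the force-balance
EQUATIONS can: for a separated Lennard-Jones equilibrium that is EVERYWHERE locally `η₀`-close to isometric
copies of the relaxed hcp two-lattice `hcpStacking a h`, the strain is pointwise `≤ η₀` a priori (no BMO
loss for the strain; rotations are slaved to strain gradients by compatibility and stay within `Cη₀ log L`
of a constant up to exponentially large scales `L` by F. John's rotation–strain estimate), and interior
(Campanato) estimates for the linearised force-constant system — Legendre–Hadamard by harmonic stability of
`hcp(a,h)` — make the strain gradient decay like `η₀/s` at depth `s`; in blow-down form this is a LIOUVILLE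
theorem with LOCAL charts (`LocalLiouville`): such an infinite equilibrium is globally `1/80`-matched with ONE
admissible affine hcp datum.  Compactness (`CompactnessGlue`) turns it into the finite statement "a particle
whose `ρ(R)`-neighbourhood is entirely locally hcp carries a `1/40`-grain of radius `R`", a packing
pigeonhole (`CleanBall`) finds such a particle once all but `κN` particles are locally hcp, and the
energetic input is exactly that: `LocalOrder` — one-scale local hcp-likeness with `o(N)` exceptions, w.r.t.
isometric copies of ONE pinned relaxed cell `(a, h)` (triage sharpenings 1–2: charts ROOTED AT PARTICLES,
TWO-WAY, ISOMETRIC copies of the relaxed hcp, not the floating 1/40 window).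

Registered stubs (sorried): `stub_localOrder` (crystallization-strength energetic core; hardest),
`stub_localLiouville` (the lever; L–XL), `stub_compactnessGlue` (L), `stub_cleanBall` (M),
`stub_groundStateForceBalance` (= route support `ForceBalance`, stmt-9335; provable now),
`stub_hcpHarmonicStability` (the pinned, ideal-shift instance of route crux `PhononStability`, stmt-9333; L,
certified lattice sums).  Composition (sorry-free): `coarseGrains_of_parts`, `CoarseGrains_of`.

Disproof.lean: none published for this crux at planning time (`ledger crux ls`, 2026-08-15) — nothing cited.
Negatives honoured: stmt-3506 (`OneGrainGluing`, piling without separation) — every configuration-level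
stub carries `Sep X δ` / the minimal distance of ground states (`LennardJonesMinimalDistance_holds`);
stmt-4146 (`EffectiveLocalHales`, decahedral soft shell) — no contact-graph rigidity is used, charts are
two-way matchings with a full two-lattice ball.
-/

noncomputable section

open scoped BigOperators Classical
open Set Filter Topology

namespace Summit.AtomisticToContinuum.Crystallization.Cruxes.CoarseGrains.InteriorOscillationDecay

open Literature.MathematicalPhysics.StatisticalMechanics (triangularVec₁ triangularVec₂ barlowOffset
  layerNormal hcpStacking lennardJones IsGroundState LennardJonesMinimalDistance_holds)

local notation "E3" => EuclideanSpace ℝ (Fin 3)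

/-! ## Vocabulary (verbatim bodies of the `let`s of the route file `ExcessDecayLiouville`) -/

/-- `Λ`: the period lattice `ℤu + ℤv + ℤ·2√(2/3)e₃` of the unit hcp stacking. -/
def hcpPeriods : Set E3 :=
  {z | ∃ i j k : ℤ, z = (i : ℝ) • triangularVec₁ 1 + (j : ℝ) • triangularVec₂ 1 +
    (k : ℝ) • layerNormal (2 * Real.sqrt (2 / 3))}

/-- `Near X c r t A ε`: two-way `ε`-matching of `X` on `B_r(c)` with the affine two-lattice
`{t m + A z : m ∈ {0,1}, z ∈ Λ}` (route `let Near`). -/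
def Near (X : Set E3) (c : E3) (r : ℝ) (t : Fin 2 → E3) (A : E3 →L[ℝ] E3) (ε : ℝ) : Prop :=
  (∀ p ∈ X, dist p c ≤ r → ∃ m : Fin 2, ∃ z ∈ hcpPeriods, dist p (t m + A z) ≤ ε) ∧
  (∀ m : Fin 2, ∀ z ∈ hcpPeriods, dist (t m + A z) c ≤ r → ∃ p ∈ X, dist p (t m + A z) ≤ ε)

/-- `Adm A`: admissible cell, `‖A − 0.97·R‖ ≤ 1/40` for a linear isometry `R` (route `let Adm`). -/
def Adm (A : E3 →L[ℝ] E3) : Prop :=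
  ∃ R : E3 ≃ₗᵢ[ℝ] E3, ‖A - (97 / 100 : ℝ) • (R.toContinuousLinearEquiv : E3 →L[ℝ] E3)‖ ≤ 1 / 40

/-- `Inner t A`: hcp-like inner displacement (route `let Inner`). -/
def Inner (t : Fin 2 → E3) (A : E3 →L[ℝ] E3) : Prop :=
  ‖t 1 - t 0 - A (barlowOffset 1 + layerNormal (Real.sqrt (2 / 3)))‖ ≤ 1 / 40

/-- `Sep X δ`: `δ`-separation (route `let Sep`). -/
def Sep (X : Set E3) (δ : ℝ) : Prop := ∀ p ∈ X, ∀ q ∈ X, p ≠ q → δ ≤ dist p q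

/-- `Equil X`: Lennard-Jones force balance at every particle, `HasSum` form (route `let Equil`). -/
def Equil (X : Set E3) : Prop :=
  ∀ p ∈ X, HasSum (fun q : {q : E3 // q ∈ X ∧ q ≠ p} =>
    (deriv lennardJones (dist p q.1) / dist p q.1) • (p - q.1)) 0

/-- The LJ bond Hessian `wᵀK(e)w`, `K(e) = V″(|e|) ê⊗ê + (V′(|e|)/|e|)(1 − ê⊗ê)` (route `let Hess`). -/
def ljHess (e w : E3) : ℝ :=
  deriv (deriv lennardJones) ‖e‖ * (inner ℝ e w / ‖e‖) ^ 2 +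
    deriv lennardJones ‖e‖ / ‖e‖ * (‖w‖ ^ 2 - (inner ℝ e w / ‖e‖) ^ 2)

/-! ## Objects of the line -/

/-- LOCAL HCP CHART ROOTED AT A PARTICLE (triage sharpenings 1–2): `X` is two-way `η`-matched on
`B_ρ(q)` with the isometric copy `q + O(hcpStacking a h)` of the relaxed hcp two-lattice (`0` is a site;
hcp is vertex-transitive, so origin-based charts lose nothing; `O` a linear isometry, improper allowed —
hcp is centrosymmetric up to translation). Same shape as the `Good` predicate of route `HcpDefectCounting`
(stmt-14476/14478), for a point SET. -/
def LocHcp (a h : ℝ) (X : Set E3) (q : E3) (ρ η : ℝ) : Prop :=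
  ∃ O : E3 →ₗᵢ[ℝ] E3,
    (∀ p ∈ hcpStacking a h, ‖p‖ ≤ ρ → ∃ y ∈ X, dist y (q + O p) ≤ η) ∧
    (∀ y ∈ X, dist y q ≤ ρ → ∃ p ∈ hcpStacking a h, dist y (q + O p) ≤ η)

/-- PINNED REFERENCE CELL: in-layer spacing `a` and layer spacing `h` of the reference hcp within the
HALF window around `0.97` / `0.97·√(2/3)` (relaxed LJ values `a* = 0.9712`, `h* = 0.7930` sit inside with
margin `≥ 0.009`); the associated cell `diag(a, a, h/√(2/3))` is then `1/80`-admissible, leaving `1/80`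
of the `Adm`/`Inner` windows for elastic corrections. -/
def Pinned (a h : ℝ) : Prop :=
  |a - 97 / 100| ≤ 1 / 80 ∧ |h - 97 / 100 * Real.sqrt (2 / 3)| ≤ 1 / 100

/-- HARMONIC (ACOUSTIC + OPTICAL) STABILITY OF THE SINGLE TWO-LATTICE `hcpStacking a h` under
Lennard-Jones: the second variation at the (force-balanced, by the site symmetry `D_{3h}`) homogeneous
configuration dominates the nearest-neighbour strain norm. Verbatim the inequality of route crux
`PhononStability` (stmt-9333) specialised to ONE datum with the ideal inner shift. -/
def HcpStable (a h : ℝ) : Prop :=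
  ∃ κ : ℝ, 0 < κ ∧ ∀ u : E3 → E3, (Function.support u).Finite → Function.support u ⊆ hcpStacking a h →
    κ * (∑' p : hcpStacking a h, ∑' q : hcpStacking a h,
          if dist (p : E3) q ≤ 11 / 10 then ‖u p - u q‖ ^ 2 else 0) ≤
      (∑' p : hcpStacking a h, ∑' q : hcpStacking a h,
          if (p : E3) ≠ q then ljHess ((p : E3) - q) (u p - u q) else 0) / 2

/-- The conclusion shape of the local Liouville theorem, packaged (it is the hypothesis of the
compactness glue): every nonempty `δ`-separated LJ equilibrium that is EVERYWHERE locally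
`(r₀, η₀)`-hcp`(a,h)` is GLOBALLY (every centre, every radius) two-way `1/80`-matched with one admissible
affine hcp two-lattice datum with hcp-like inner displacement. -/
def GlobalRigidity (a h δ r₀ η₀ : ℝ) : Prop :=
  ∀ X : Set E3, X.Nonempty → Sep X δ → Equil X → (∀ q ∈ X, LocHcp a h X q r₀ η₀) →
    ∃ (t : Fin 2 → E3) (A : E3 →L[ℝ] E3), Adm A ∧ Inner t A ∧ ∀ (c : E3) (r : ℝ), Near X c r t A (1 / 80)

/-! ## Stub statements -/

/-- S1 · ONE-SCALE LOCAL ORDER WITH `o(N)` EXCEPTIONS (the energetic, crystallization-strength core;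
the restriction of `BulkDefectVanish` stmt-0751 to hcp charts with a pinned relaxed cell, in the uniform
`∃ N₀` form of the crux): there is ONE reference cell `(a, h)` in the pinned window such that for every
chart radius `ρ`, tolerance `θ` and fraction `κ > 0`, in every sufficiently large LJ ground state all but
`κN` particles carry a two-way `(ρ, θ)`-chart onto an isometric copy of `hcpStacking a h` rooted at the
particle. The skeleton consumes it at ONE instance `(r₀ + 1, η₀, κ(δ, ρ(R)))`; it is registered in the
`∀` form only because `η₀` of `LocalLiouville` is not explicit. Expected proof: Theil-type defect-counting
coercivity at radius 4 for every `θ` (`HcpDefectCoercivity` 14476) under the bulk floor (`HcpBulkFloor`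
14477, with the certified pin `(a,h) ∈ Pinned`), the trial bound `E(N) ≤ N e(hcp) + C N^{2/3}`, and chart
gluing radius `4 → ρ` (`HcpChartGluing` 14478). -/
def LocalOrder : Prop :=
  ∃ a h : ℝ, Pinned a h ∧ ∀ ρ θ κ : ℝ, 0 < ρ → 0 < θ → 0 < κ → ∃ N₀ : ℕ, ∀ N : ℕ, N₀ ≤ N →
    ∀ x : Fin N → E3, IsGroundState lennardJones x →
      (Nat.card {i : Fin N // ¬ LocHcp a h (Set.range x) (x i) ρ θ} : ℝ) ≤ κ * N

/-- S2 · LOCAL LIOUVILLE THEOREM AT SMALL TOLERANCE (the lever of the line; conditional on harmonic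
stability of the reference, inline): for the pinned cell and every separation `δ` there are a chart
radius `r₀` and a tolerance `η₀ > 0` such that `GlobalRigidity a h δ r₀ η₀` holds — an infinite separated
LJ equilibrium which is everywhere LOCALLY `η₀`-hcp (floating isometric charts) is GLOBALLY `1/80`-close
to ONE admissible affine two-lattice. Mechanism: a priori the strain is pointwise `≲ η₀/r₀` and, by
compatibility (`curl F = 0` ⇒ `|∇Q| ≲ |∇e|`) and F. John's rotation–strain theorem, rotations stay
`Cη₀ log L`-close to a constant on scales `L ≤ exp(c/η₀)`; on those scales the linearised system about
`Q₀·hcp(a,h)` has constant Legendre–Hadamard coefficients (`HcpStable`, acoustic + optical) up to an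
`ℓ^∞`-small perturbation, so Campanato/Meyers interior estimates give `[F]_{C^α(B_{L/2})} ≲ L^{-α} η₀ log L`,
which is super-exponentially small at `L = exp(c/η₀)` and bootstraps to all scales: `∇e ≡ 0`, `∇Q ≡ 0`,
the configuration is `Cη₀ ≤ 1/80`-close to one affine datum whose cell is `1/80 + Cη₀ ≤ 1/40`-admissible
and whose inner shift is relaxed (`= ideal ± O(strain)` by the `D_{3h}` symmetry). Exterior matter is
absent (hypothesis at every particle). Distinct from `HcpLiouville` (stmt-9332: ONE GLOBAL datum at the
coarse tolerance 1/40 ⇒ exact) and from `ExcessDecay` (stmt-9334: one datum on one ball, rate form). -/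
def LocalLiouville : Prop :=
  ∀ a h δ : ℝ, Pinned a h → 0 < δ → HcpStable a h →
    ∃ r₀ η₀ : ℝ, 0 < r₀ ∧ 0 < η₀ ∧ GlobalRigidity a h δ r₀ η₀

/-- S3 · COMPACTNESS GLUE (finite form of the Liouville theorem; soft): if `GlobalRigidity a h δ r₀ η₀`
holds then for every `R > 0` there is a radius `ρ` such that every FINITE `δ`-separated LJ equilibrium
whose particles within `ρ` of a particle `p₀` all carry `(r₀ + 1, η₀)`-charts is two-way `1/40`-matched
on `B_R(p₀)` with an admissible hcp datum. Proof by contradiction and local (Hausdorff-on-balls)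
compactness of `δ`-separated sets translated to `p₀ = 0` along `ρ_k → ∞`: the limit is nonempty,
separated, in force balance (near field by local convergence and continuity of `V′` on `[δ, ∞)`, far field
`∑_{|q−p| ≥ L} |V′| ≤ C L⁻⁴` uniformly by separation), everywhere `(r₀, η₀)`-chartable (charts pass to the
limit by compactness of `O(3)`; the unit of extra radius absorbs the boundary), hence globally
`1/80`-matched; matching at `1/80 + o(1) ≤ 1/40` transfers back to `X_k` on `B_R` — contradiction.
Same technology as route support `GrainsGlue` (stmt-9336). -/
def CompactnessGlue : Prop :=
  ∀ a h δ r₀ η₀ : ℝ, Pinned a h → 0 < δ → 0 < r₀ → 0 < η₀ → GlobalRigidity a h δ r₀ η₀ →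
    ∀ R : ℝ, 0 < R → ∃ ρ : ℝ, 0 < ρ ∧ ∀ X : Set E3, X.Finite → Sep X δ → Equil X →
      ∀ p₀ ∈ X, (∀ q ∈ X, dist q p₀ ≤ ρ → LocHcp a h X q (r₀ + 1) η₀) →
        ∃ (t : Fin 2 → E3) (A : E3 →L[ℝ] E3), Adm A ∧ Inner t A ∧ Near X p₀ R t A (1 / 40)

/-- S4 · CLEAN BALL BY PACKING PIGEONHOLE (triage sharpening 1: the ball is ROOTED AT A PARTICLE and
selected by COUNTING bad particles): for `δ`-separated configurations, if at most `κ(δ, r)·N` particles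
are bad then some particle has no bad particle within distance `r` — each bad particle spoils at most
`(2r/δ + 1)³` particles (`card_le_of_separated_of_dist_le`, tree), so `κ < (2r/δ + 1)⁻³` works. -/
def CleanBall : Prop :=
  ∀ δ r : ℝ, 0 < δ → 0 < r → ∃ κ : ℝ, 0 < κ ∧ ∀ (N : ℕ) (x : Fin N → E3) (Bad : Fin N → Prop),
    0 < N → (∀ i j : Fin N, i ≠ j → δ ≤ dist (x i) (x j)) →
      (Nat.card {i : Fin N // Bad i} : ℝ) ≤ κ * N →
        ∃ i₀ : Fin N, ∀ j : Fin N, dist (x j) (x i₀) ≤ r → ¬ Bad j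

/-- S5 · GROUND STATES ARE FORCE-BALANCED POINT SETS — definitionally the route support item
`ForceBalance` (stmt-9335; Fermat on the open set of injective configurations; provable now). -/
def GroundStateForceBalance : Prop :=
  ∀ (N : ℕ) (x : Fin N → E3), IsGroundState lennardJones x → Equil (Set.range x)

/-- S6 · HARMONIC STABILITY OF LJ-HCP ON THE PINNED WINDOW (the instance of route crux
`PhononStability`, stmt-9333, that this line uses: a 2-parameter box of symmetric cells with the IDEAL
inner shift instead of the 12-dimensional admissible window; certified Bloch-matrix interval arithmetic,
float scan κ ≈ 0.46 at the relaxed cell by refuter g41-54). -/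
def HcpHarmonicStability : Prop := ∀ a h : ℝ, Pinned a h → HcpStable a h

/-! ## Registered stubs -/

/-- STUB S1 (open-problem; the HARDEST — crystallization-strength LJ energetics incl. stacking
selection): one-scale local hcp order with `o(N)` exceptions. -/
theorem stub_localOrder : LocalOrder := by
  sorry

/-- STUB S2 (L–XL; the line's load-bearing NEW lemma): local Liouville theorem at small tolerance. -/
theorem stub_localLiouville : LocalLiouville := by
  sorry

/-- STUB S3 (L; soft compactness): finite form of the Liouville theorem. -/
theorem stub_compactnessGlue : CompactnessGlue := by
  sorry

/-- STUB S4 (M; packing): a ball rooted at a particle and free of bad particles. -/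
theorem stub_cleanBall : CleanBall := by
  sorry

/-- STUB S5 (M, provable now; = stmt-9335 `ForceBalance`). -/
theorem stub_groundStateForceBalance : GroundStateForceBalance := by
  sorry

/-- STUB S6 (L, certified computation; pinned instance of stmt-9333 `PhononStability`). -/
theorem stub_hcpHarmonicStability : HcpHarmonicStability := by
  sorry

/-! ## Composition (sorry-free) -/

/-- `GroundStateForceBalance` IS the route item `ForceBalance` (definitional audit). -/
theorem groundStateForceBalance_iff :
    GroundStateForceBalance ↔
      _root_.Summit.AtomisticToContinuum.Crystallization.Theses.ExcessDecayLiouville.ForceBalance :=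
  Iff.rfl

/-- Ground states are separated point sets (`Sep` of the range, from the proved Literature fact
`LennardJonesMinimalDistance_holds`, `δ = 1/3`). -/
theorem sep_range_of_pairwise {δ : ℝ} {N : ℕ} {x : Fin N → E3}
    (hx : ∀ i j : Fin N, i ≠ j → δ ≤ dist (x i) (x j)) : Sep (Set.range x) δ := by
  rintro p ⟨i, rfl⟩ q ⟨j, rfl⟩ hne
  exact hx i j fun hij => hne (congrArg x hij)

/-- **Composition of the line.** From the six stub statements: the crux in unfolded form — for every
`R > 0`, every large LJ ground state carries a ball `B_R(x i₀)`, rooted at a particle, two-way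
`1/40`-matched with an admissible affine hcp two-lattice with hcp-like inner displacement. Order of
instantiation: `δ` (minimal distance, tree) → `(a, h)` (S1) → `(r₀, η₀)` (S2 fed by S6) → `ρ(R)` (S3) →
`κ(δ, ρ)` (S4) → `N₀(r₀ + 1, η₀, κ)` (S1) → clean particle `i₀` (S4) → datum (S3 fed by S5). -/
theorem coarseGrains_of_parts (h₁ : LocalOrder) (h₂ : LocalLiouville) (h₃ : CompactnessGlue)
    (h₄ : CleanBall) (h₅ : GroundStateForceBalance) (h₆ : HcpHarmonicStability) :
    ∀ R : ℝ, 0 < R → ∃ N₀ : ℕ, ∀ N : ℕ, N₀ ≤ N → ∀ x : Fin N → E3, IsGroundState lennardJones x →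
      ∃ (c : E3) (t : Fin 2 → E3) (A : E3 →L[ℝ] E3),
        Adm A ∧ Inner t A ∧ Near (Set.range x) c R t A (1 / 40) := by
  intro R hR
  obtain ⟨δ, hδ, hsep⟩ := LennardJonesMinimalDistance_holds
  obtain ⟨a, h, hpin, hloc⟩ := h₁
  obtain ⟨r₀, η₀, hr₀, hη₀, hrig⟩ := h₂ a h δ hpin hδ (h₆ a h hpin)
  obtain ⟨ρ, hρ, hfin⟩ := h₃ a h δ r₀ η₀ hpin hδ hr₀ hη₀ hrig R hR
  obtain ⟨κ, hκ, hsel⟩ := h₄ δ ρ hδ hρ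
  obtain ⟨N₀, hN₀⟩ := hloc (r₀ + 1) η₀ κ (by linarith) hη₀ hκ
  refine ⟨N₀ + 1, fun N hN x hx => ?_⟩
  have hNpos : 0 < N := by omega
  have hsepx : ∀ i j : Fin N, i ≠ j → δ ≤ dist (x i) (x j) := hsep N x hx
  have hcount := hN₀ N (by omega) x hx
  obtain ⟨i₀, hi₀⟩ :=
    hsel N x (fun i => ¬ LocHcp a h (Set.range x) (x i) (r₀ + 1) η₀) hNpos hsepx hcount
  obtain ⟨t, A, hA, hI, hNear⟩ :=
    hfin (Set.range x) (Set.finite_range x) (sep_range_of_pairwise hsepx) (h₅ N x hx) (x i₀) ⟨i₀, rfl⟩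
      (by
        rintro q ⟨j, rfl⟩ hj
        exact Classical.not_not.mp (hi₀ j hj))
  exact ⟨x i₀, t, A, hA, hI, hNear⟩

/-- **The skeleton concludes the crux BY NAME.** `ExcessDecayLiouville.CoarseGrains`
(stmt-AtomisticToContinuum-9331) from the six registered stubs; the route's `let`-bound `Λ`, `Near`,
`Adm`, `Inner` are definitionally the vocabulary above. -/
theorem CoarseGrains_of :
    _root_.Summit.AtomisticToContinuum.Crystallization.Theses.ExcessDecayLiouville.CoarseGrains :=
  coarseGrains_of_parts stub_localOrder stub_localLiouville stub_compactnessGlue stub_cleanBall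
    stub_groundStateForceBalance stub_hcpHarmonicStability

end Summit.AtomisticToContinuum.Crystallization.Cruxes.CoarseGrains.InteriorOscillationDecay

end
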